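/-
Copyright (c) 2026 the pub-hodgecm-mathlib formalisation cell (harness21).  Prover seat hodgecm-mathlib-K2E4-p11 (g4), Track B ∕ K2-LIT, h413 =
`stmt-HodgeConjecture-24833`, line `K2_E1_TraceFormulaBeta`, campaign «EIS-RANK-ONE», rung R6h ∕ [D5]₃ E-LAYER, deal (E-c) of K2E1-plan (g4) 2026-09-04T07:22:26Z ∕ 07:44:09Z:
THE CENTRE AVERAGE OF THE SPHERICAL SECTION OF `U(2,1)` OVER A CM FIELD SCALES EXPLICITLY IN THE ARCHIMEDEAN HEISENBERG COORDINATE — hypothesis-free.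
-/
import Summits.HodgeConjecture.HodgeConjecture.Theorems.K2E1HeightBigCellLineFormulaU3   -- ★ (a2)₃ p858090 (K2E1-p08 (g5)): the explicit height along the big-cell Heisenberg line over a CM field
import Literature.NumberTheory.Automorphic.AdelicPoissonScaled                            -- ★ `integral_comp_smul_eq_distribHaarChar_inv_smul`; brings ★ `AdeleRing.distribHaarChar_eq_ideleNorm`
import Mathlib.NumberTheory.NumberField.CMField
import HarnessLib

/-!
# h413 ∕ Track B «K2-LIT», «EIS-RANK-ONE» [D5]₃ (E-c) — `K2E1CentreAverageScalingU3`: the centre average `∫_{𝔸_{L⁺}} φ₀·H(ι(w₀)·u((a,B), θt)·k)^z dμ(t)`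
# equals `(∏_{w∣∞} (1 + ½‖a_w‖²))^{1−2z} · ∫_{𝔸_{L⁺}} φ₀·H(ι(w₀)·u((0,B), θt)·k)^z dμ(t)` — HYPOTHESIS-FREE (Tate's module by a measurable equivalence)

Cell `pub/hodgecm-mathlib`, crux H413 = `stmt-HodgeConjecture-24833`, route `HCCMUnconditional`; dealer K2E1-plan (g4), deal (E-c) 07:22:26Z, instruction 07:44:09Z («state the
idele-scaling identities HYPOTHESIS-FREE»), REPORT-FIRST 07:45Z.  THEOREMS ONLY (no `def`, no `instance`, no `notation`, no named-fact hypothesis, no `sorry`); lane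
`--kind proof --supports stmt-HodgeConjecture-24833 --as helper` (count-neutral).
THE COMPUTATION.  ★ (a2)₃ `coe_borelHeight_weylLongU_heisChart_line_mul_eq_cm_three`: `H(ι(w₀)·u(X, θ(ι⁻¹s, b))·k) = (∏_w (A_w + c_w s_{w|L⁺}²) · h_f(X_f, b))⁻¹`, `A_w = (1+½‖X_w‖²)²`,
`c_w = (wδ)²`.  For `X = (a, B)` put `p_w = 1 + ½‖a_w‖² ≥ 1` and let `D = D(a) ∈ 𝕀_{L⁺}` be the archimedean idele with component `p_{w(v)}` at the (real) place `v` of `L⁺` under the UNIQUE place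
`w(v)` of `L` (Mathlib `NumberField.IsCMField.equivInfinitePlace`), `1` at the finite places: `‖D‖ = ∏_w p_w` and, POINTWISE in `t`, `H(ι(w₀)·u((a,B), θ(D·t))·k) = (∏_w p_w)⁻²·H(ι(w₀)·u((0,B), θt)·k)`
(`A_w + c_w(p_w s_w)² = p_w²·(1 + c_w s_w²)`, the finite factor sees only `X_f = B`).  Tate's module `∫ f = ‖D‖·∫ f(D·t)` (a measurable equivalence: NO integrability, both sides junk together) gives
`∫ φ₀ H((a,B),t)^z dt = (∏p_w)·((∏p_w)⁻²)^z·∫ φ₀ H((0,B),t)^z dt = (∏p_w)^{1−2z}·∫ …` and the same with the real power `σ`.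
* §1 `integral_comp_units_mul_eq_smul` (any number field, any Banach codomain): `∫ f(a·x) dμ = ‖a‖⁻¹ • ∫ f dμ`, HYPOTHESIS-FREE.
* §1b scalar plumbing (`P·(P⁻²)^z = P^{1−2z}`, constants out of `∫`).
* §2 `exists_archDilate_idele_cm` — the idele `D(a)`: `‖D‖ = ∏_w p_w`, finite part fixed, real coordinates dilated by `p_w`.
* §3 `exists_archDilate_borelHeight_cm_three` (pointwise scaling of the height), **`integral_sphericalCentreLine_cpow_eq_prod_cpow_mul_cm_three`** (`φ₀·H^z`, complex power; also in
  `flatSectionU` form) and **`integral_sphericalCentreLine_rpow_eq_prod_rpow_mul_cm_three`** (`C·H^σ`, real power) — the (E-c) identities consumed by (E-d) `K2E1HeightLineArchSmoothU3E`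
  (the `hφarchZ` payer of ★ p858259).
HONEST LABEL.  Count-neutral helper; proves no printed statement; HC_CM is proved only modulo the 7 printed citations (2 remaining named inputs: hLiu418 =
`stmt-HodgeConjecture-24832`, h413 = `stmt-HodgeConjecture-24833`) until rung 0 closes.

## References
* [MoeglinWaldspurger1995] C. Mœglin, J.-L. Waldspurger, *Spectral decomposition and Eisenstein series* (1995), I.2.2, II.1.6–II.1.7.
* [CasselsFrohlichANT1967] J. Tate, *Fourier analysis in number fields and Hecke's zeta-functions*, in Cassels–Fröhlich (1967), Ch. XV Lemma 4.1.2.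
* [Garrett2018] P. Garrett, *Modern Analysis of Automorphic Forms by Example* 1 (2018), §2.2, §2.8.
-/

set_option autoImplicit false
set_option linter.dupNamespace false  -- the mandated namespace repeats the summit's segment (`HodgeConjecture.HodgeConjecture`)

noncomputable section

open MeasureTheory Measure NumberField NumberField.InfinitePlace NumberField.mixedEmbedding IsDedekindDomain
open Literature.NumberTheory.Automorphic Literature.NumberTheory.Automorphic.UnitaryGroup AdelicGroupData
open Summit.HodgeConjecture.HodgeConjecture.Cruxes.H413.K2E1BorelEisensteinU (flatSectionU flatSectionU_apply)
open Summit.HodgeConjecture.HodgeConjecture.Cruxes.H413.K2E1HeightBigCellLineFormulaU3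
open Summit.HodgeConjecture.HodgeConjecture.Cruxes.H413.K2E1HeightBigCellLineFormulaU2 (norm_ringEquiv_mixedSpace_symm_apply)
-- `Classical` is needed to see the Mathlib normed-space instances on `mixedSpace` (note H5 of `AdelicGLnGlue`)
open scoped NNReal Classical

namespace Summit.HodgeConjecture.HodgeConjecture.Cruxes.H413.K2E1CentreAverageScalingU3

/-! ## §1 Tate's module, hypothesis-free -/

section Module

/-- **`∫ f(a·x) dμ(x) = ‖a‖⁻¹ • ∫ f dμ`** for an idele `a`, an additive Haar measure `μ` on `𝔸_K` and ANY `f` with values in a real Banach space — no integrability (`x ↦ a·x` is a measurable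
equivalence, both sides are Bochner junk together); ★ `integral_comp_smul_eq_distribHaarChar_inv_smul` + ★ `AdeleRing.distribHaarChar_eq_ideleNorm`. [cite: CasselsFrohlichANT1967, Ch. XV Lemma 4.1.2] -/
theorem integral_comp_units_mul_eq_smul (K : Type) [Field K] [NumberField K] [MeasurableSpace (AdeleRing (𝓞 K) K)] [BorelSpace (AdeleRing (𝓞 K) K)]
    (μ : Measure (AdeleRing (𝓞 K) K)) [μ.IsAddHaarMeasure] {V : Type*} [NormedAddCommGroup V] [NormedSpace ℝ V] (a : (AdeleRing (𝓞 K) K)ˣ) (f : AdeleRing (𝓞 K) K → V) :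
    ∫ x, f ((a : AdeleRing (𝓞 K) K) * x) ∂μ = ((IdeleClassGroup.ideleNorm K a : ℝ≥0) : ℝ)⁻¹ • ∫ x, f x ∂μ := by
  haveI : LocallyCompactSpace (AdeleRing (𝓞 K) K) := locallyCompactSpace_adeleRing' K
  haveI : SecondCountableTopology (AdeleRing (𝓞 K) K) := secondCountableTopology_adeleRing K
  haveI : μ.Regular := by infer_instance
  have h := integral_comp_smul_eq_distribHaarChar_inv_smul μ a f
  simp only [Units.smul_def, smul_eq_mul] at h
  rw [h, AdeleRing.distribHaarChar_eq_ideleNorm K a⁻¹, map_inv, NNReal.coe_inv]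

end Module


/-! ## §1b Scalar algebra of the scaling (plumbing) -/

section Algebra

/-- `P · (P⁻²)^z = P^{1−2z}` for `P > 0` (complex power of a positive real base). [folklore] -/
theorem ofReal_mul_inv_sq_cpow {P : ℝ} (hP : 0 < P) (z : ℂ) :
    (P : ℂ) * ((((P ^ 2)⁻¹ : ℝ)) : ℂ) ^ z = (P : ℂ) ^ (1 - 2 * z) := by
  have hP0 : (P : ℂ) ≠ 0 := Complex.ofReal_ne_zero.mpr hP.ne'
  have hP2 : ((((P ^ 2)⁻¹ : ℝ)) : ℂ) ≠ 0 := Complex.ofReal_ne_zero.mpr (inv_ne_zero (pow_ne_zero 2 hP.ne'))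
  have hlog2 : Complex.log ((((P ^ 2)⁻¹ : ℝ)) : ℂ) = -2 * Complex.log (P : ℂ) := by
    rw [← Complex.ofReal_log (inv_nonneg.mpr (pow_nonneg hP.le 2)), Real.log_inv, Real.log_pow, ← Complex.ofReal_log hP.le]
    push_cast
    ring
  rw [Complex.cpow_def_of_ne_zero hP2, Complex.cpow_def_of_ne_zero hP0, hlog2]
  have h1 : Complex.exp (Complex.log (P : ℂ)) = (P : ℂ) := Complex.exp_log hP0
  calc (P : ℂ) * Complex.exp (-2 * Complex.log (P : ℂ) * z)
      = Complex.exp (Complex.log (P : ℂ)) * Complex.exp (-2 * Complex.log (P : ℂ) * z) := by rw [h1]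
    _ = Complex.exp (Complex.log (P : ℂ) * (1 - 2 * z)) := by
      rw [← Complex.exp_add]
      congr 1
      ring

/-- `P · (P⁻²)^σ = P^{1−2σ}` for `P > 0` (real power). [folklore] -/
theorem mul_inv_sq_rpow {P : ℝ} (hP : 0 < P) (σ : ℝ) : P * ((P ^ 2)⁻¹) ^ σ = P ^ (1 - 2 * σ) := by
  rw [show (P ^ 2)⁻¹ = P ^ (-2 : ℝ) by rw [Real.rpow_neg hP.le, Real.rpow_two], ← Real.rpow_mul hP.le,
    show (1 - 2 * σ) = 1 + (-2) * σ by ring, Real.rpow_add hP, Real.rpow_one]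

/-- `∫ φ₀·(c·h)^z = c^z · ∫ φ₀·h^z` for a constant `c ≥ 0` and `h ≥ 0` (complex power; `integral_const_mul`, hypothesis-free). [folklore] -/
theorem integral_const_mul_ofReal_mul_cpow {α : Type*} [MeasurableSpace α] (μ : Measure α) (φ₀ z : ℂ) {c : ℝ} (hc : 0 ≤ c) (h : α → ℝ≥0) :
    ∫ t, φ₀ * (((c * (h t : ℝ) : ℝ)) : ℂ) ^ z ∂μ = (c : ℂ) ^ z * ∫ t, φ₀ * (((h t : ℝ)) : ℂ) ^ z ∂μ := by
  rw [← integral_const_mul]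
  refine integral_congr_ae (Filter.Eventually.of_forall fun t => ?_)
  show φ₀ * (((c * (h t : ℝ) : ℝ)) : ℂ) ^ z = (c : ℂ) ^ z * (φ₀ * (((h t : ℝ)) : ℂ) ^ z)
  rw [Complex.ofReal_mul, Complex.mul_cpow_ofReal_nonneg hc (h t).coe_nonneg]
  ring

/-- `∫ C·(c·h)^σ = c^σ · ∫ C·h^σ` for a constant `c ≥ 0` and `h ≥ 0` (real power; hypothesis-free). [folklore] -/
theorem integral_const_mul_mul_rpow {α : Type*} [MeasurableSpace α] (μ : Measure α) (C σ : ℝ) {c : ℝ} (hc : 0 ≤ c) (h : α → ℝ≥0) :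
    ∫ t, C * (c * (h t : ℝ)) ^ σ ∂μ = c ^ σ * ∫ t, C * ((h t : ℝ)) ^ σ ∂μ := by
  rw [← integral_const_mul]
  refine integral_congr_ae (Filter.Eventually.of_forall fun t => ?_)
  show C * (c * (h t : ℝ)) ^ σ = c ^ σ * (C * ((h t : ℝ)) ^ σ)
  rw [Real.mul_rpow hc (h t).coe_nonneg]
  ring

end Algebra

/-! ## §2 The archimedean dilating idele of a CM field -/

section CM

variable (L : Type) [Field L] [NumberField L] [IsCMField L]

omit [NumberField L] [IsCMField L] in
/-- `p_w(a) = 1 + ½‖a_w‖² ≥ 1 > 0` (plumbing). [folklore] -/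
theorem one_add_half_norm_sq_pos (a : InfiniteAdeleRing L) (w : InfinitePlace L) : 0 < 1 + ‖a w‖ ^ 2 / 2 := by positivity

/-- **THE DILATING IDELE.**  For `a ∈ L ⊗ ℝ` there is `D ∈ 𝕀_{L⁺}` with (i) `‖D‖ = ∏_{w∣∞} (1 + ½‖a_w‖²)` and (ii) `D` acts on `𝔸_{L⁺} = (L⁺ ⊗ ℝ) × 𝔸_{L⁺}^∞` by fixing the finite part and
multiplying the real coordinate under each place `w` of `L` by `1 + ½‖a_w‖²` (the place of `L⁺` under `w` determines `w`: Mathlib `IsCMField.equivInfinitePlace`).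
[cite: CasselsFrohlichANT1967, Ch. XV Lemma 4.1.2] [cite: MoeglinWaldspurger1995, I.2.2] -/
theorem exists_archDilate_idele_cm (a : InfiniteAdeleRing L) :
    ∃ D : (AdeleRing (𝓞 ↥(maximalRealSubfield L)) ↥(maximalRealSubfield L))ˣ,
      ((IdeleClassGroup.ideleNorm ↥(maximalRealSubfield L) D : ℝ≥0) : ℝ) = ∏ w : InfinitePlace L, (1 + ‖a w‖ ^ 2 / 2) ∧
      ∀ t : AdeleRing (𝓞 ↥(maximalRealSubfield L)) ↥(maximalRealSubfield L),
        ((D : AdeleRing (𝓞 ↥(maximalRealSubfield L)) ↥(maximalRealSubfield L)) * t).2 = t.2 ∧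
        ∀ w : InfinitePlace L,
          (InfiniteAdeleRing.ringEquiv_mixedSpace ↥(maximalRealSubfield L) ((D : AdeleRing (𝓞 ↥(maximalRealSubfield L)) ↥(maximalRealSubfield L)) * t).1).1
              ⟨w.comap (algebraMap ↥(maximalRealSubfield L) L), K2E1HeightBigCellLineFormulaU2.isReal_comap_maximalRealSubfield L w⟩ =
            (1 + ‖a w‖ ^ 2 / 2) * (InfiniteAdeleRing.ringEquiv_mixedSpace ↥(maximalRealSubfield L) t.1).1
              ⟨w.comap (algebraMap ↥(maximalRealSubfield L) L), K2E1HeightBigCellLineFormulaU2.isReal_comap_maximalRealSubfield L w⟩ := by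
  -- the place of `L` over a real place of `L⁺`
  set e : InfinitePlace L ≃ InfinitePlace ↥(maximalRealSubfield L) := NumberField.IsCMField.equivInfinitePlace L with he
  set p : {v : InfinitePlace ↥(maximalRealSubfield L) // v.IsReal} → ℝ := fun v => 1 + ‖a (e.symm v.1)‖ ^ 2 / 2 with hp
  have hppos : ∀ v, 0 < p v := fun v => one_add_half_norm_sq_pos L a _
  have hp0 : ∀ v, p v ≠ 0 := fun v => (hppos v).ne'
  -- the archimedean element `d = (p, 1)` of the mixed space and its inverse
  set d : mixedSpace ↥(maximalRealSubfield L) := (p, fun _ => 1) with hd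
  set d' : mixedSpace ↥(maximalRealSubfield L) := (fun v => (p v)⁻¹, fun _ => 1) with hd'
  have hdd' : d * d' = 1 := Prod.ext (funext fun v => mul_inv_cancel₀ (hp0 v)) (funext fun _ => mul_one _)
  have hd'd : d' * d = 1 := by rw [mul_comm]; exact hdd'
  set ι := InfiniteAdeleRing.ringEquiv_mixedSpace ↥(maximalRealSubfield L) with hι
  set Dinf : (InfiniteAdeleRing ↥(maximalRealSubfield L))ˣ := ⟨ι.symm d, ι.symm d', by rw [← map_mul, hdd', map_one], by rw [← map_mul, hd'd, map_one]⟩ with hDinf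
  set D : (AdeleRing (𝓞 ↥(maximalRealSubfield L)) ↥(maximalRealSubfield L))ˣ :=
    (Units.map (MonoidHom.inl (InfiniteAdeleRing ↥(maximalRealSubfield L)) (FiniteAdeleRing (𝓞 ↥(maximalRealSubfield L)) ↥(maximalRealSubfield L))) Dinf :
      (InfiniteAdeleRing ↥(maximalRealSubfield L) × FiniteAdeleRing (𝓞 ↥(maximalRealSubfield L)) ↥(maximalRealSubfield L))ˣ) with hD
  have hD1 : ((D : AdeleRing (𝓞 ↥(maximalRealSubfield L)) ↥(maximalRealSubfield L))).1 = ι.symm d := rfl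
  have hD2 : ((D : AdeleRing (𝓞 ↥(maximalRealSubfield L)) ↥(maximalRealSubfield L))).2 = 1 := rfl
  refine ⟨D, ?_, fun t => ⟨?_, fun w => ?_⟩⟩
  · -- `‖D‖ = ∏_v ‖(ι⁻¹ d)_v‖ = ∏_v p_v = ∏_w (1 + ½‖a_w‖²)`
    rw [ideleNorm_apply]
    have hfin : (fun v : HeightOneSpectrum (𝓞 ↥(maximalRealSubfield L)) => ‖((D : AdeleRing (𝓞 ↥(maximalRealSubfield L)) ↥(maximalRealSubfield L))).2 v‖₊) = fun _ => 1 := by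
      funext v; rw [hD2, show (1 : FiniteAdeleRing (𝓞 ↥(maximalRealSubfield L)) ↥(maximalRealSubfield L)) v = 1 from rfl, nnnorm_one]
    rw [hfin, finprod_one, mul_one, NNReal.coe_prod]
    have hterm : ∀ v : InfinitePlace ↥(maximalRealSubfield L), ((‖((D : AdeleRing (𝓞 ↥(maximalRealSubfield L)) ↥(maximalRealSubfield L))).1 v‖₊ ^ v.mult : ℝ≥0) : ℝ) = p ⟨v, IsTotallyReal.isReal v⟩ := by
      intro v
      have hv : v.IsReal := IsTotallyReal.isReal v
      rw [NNReal.coe_pow, coe_nnnorm, show v.mult = 1 from if_pos hv, pow_one, hD1, norm_ringEquiv_mixedSpace_symm_apply d v hv]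
      exact abs_of_pos (hppos _)
    simp_rw [hterm]
    exact (Fintype.prod_equiv e (fun w => 1 + ‖a w‖ ^ 2 / 2) (fun v => p ⟨v, IsTotallyReal.isReal v⟩) fun w => by
      show 1 + ‖a w‖ ^ 2 / 2 = 1 + ‖a (e.symm (e w))‖ ^ 2 / 2
      rw [Equiv.symm_apply_apply]).symm
  · rw [show ((D : AdeleRing (𝓞 ↥(maximalRealSubfield L)) ↥(maximalRealSubfield L)) * t).2 = ((D : AdeleRing (𝓞 ↥(maximalRealSubfield L)) ↥(maximalRealSubfield L))).2 * t.2 from rfl, hD2, one_mul]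
  · rw [show ((D : AdeleRing (𝓞 ↥(maximalRealSubfield L)) ↥(maximalRealSubfield L)) * t).1 = ((D : AdeleRing (𝓞 ↥(maximalRealSubfield L)) ↥(maximalRealSubfield L))).1 * t.1 from rfl, hD1, map_mul,
      RingEquiv.apply_symm_apply, Prod.fst_mul, Pi.mul_apply]
    have hw : e.symm (e w) = w := e.symm_apply_apply w
    have hp' : p ⟨w.comap (algebraMap ↥(maximalRealSubfield L) L), K2E1HeightBigCellLineFormulaU2.isReal_comap_maximalRealSubfield L w⟩ = 1 + ‖a w‖ ^ 2 / 2 := by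
      show 1 + ‖a (e.symm (e w))‖ ^ 2 / 2 = _
      rw [hw]
    show p _ * _ = _
    rw [hp']

/-! ## §3 The scaling of the height and of the centre averages -/

/-- **POINTWISE SCALING OF THE HEIGHT ALONG THE DILATED CENTRE**: with `D = D(a)` of §2 and `P = ∏_w (1 + ½‖a_w‖²)`, for every `t ∈ 𝔸_{L⁺}`, `B`, `k ∈ K_U`:
`H(ι(w₀)·u((a,B), θ(D·t))·k) = (P²)⁻¹ · H(ι(w₀)·u((0,B), θt)·k)` (★ (a2)₃ big-cell formula: `A_w + c_w(p_w s_w)² = p_w²(1 + c_w s_w²)`, the finite factor sees only `B`).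
[cite: MoeglinWaldspurger1995, I.2.2] [cite: Garrett2018, §2.2] -/
theorem exists_archDilate_borelHeight_cm_three (hc : IsCMField.complexConj L * IsCMField.complexConj L = 1) {δ : L} (hcδ : IsCMField.complexConj L δ = -δ) (hδ : δ ≠ 0)
    (a : InfiniteAdeleRing L) :
    ∃ D : (AdeleRing (𝓞 ↥(maximalRealSubfield L)) ↥(maximalRealSubfield L))ˣ, ((IdeleClassGroup.ideleNorm ↥(maximalRealSubfield L) D : ℝ≥0) : ℝ) = ∏ w : InfinitePlace L, (1 + ‖a w‖ ^ 2 / 2) ∧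
      ∀ {k : (quasiSplit (↥(maximalRealSubfield L)) L (IsCMField.complexConj L) 3).Adelic}, k ∈ ((standardMaximalCompactGL 3 L).comap (adelicVal ↥(maximalRealSubfield L) L (IsCMField.complexConj L) 3 ((StdForm.antidiagonal 3).over L)) : Subgroup (quasiSplit (↥(maximalRealSubfield L)) L (IsCMField.complexConj L) 3).Adelic) → ∀ (B : FiniteAdeleRing (𝓞 L) L) (t : AdeleRing (𝓞 ↥(maximalRealSubfield L)) ↥(maximalRealSubfield L)),
        (borelHeight (((quasiSplit (↥(maximalRealSubfield L)) L (IsCMField.complexConj L) 3).toAdelic (weylLongU ((IsCMField.complexConj L : L ≃ₐ[↥(maximalRealSubfield L)] L) : L →+* L) (rfl : ((StdForm.antidiagonal 3).over L) = ((StdForm.antidiagonal 3).over L)))) * ((heisChart hc (((a, B) : AdeleRing (𝓞 L) L), traceZeroLine ↥(maximalRealSubfield L) L (IsCMField.complexConj L) hcδ hδ ((D : AdeleRing (𝓞 ↥(maximalRealSubfield L)) ↥(maximalRealSubfield L)) * t)) : ↥(adelicUnipotent ↥(maximalRealSubfield L) L (IsCMField.complexConj L) 3)) : (quasiSplit (↥(maximalRealSubfield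 L)) L (IsCMField.complexConj L) 3).Adelic) * k) : ℝ) =
          ((∏ w : InfinitePlace L, (1 + ‖a w‖ ^ 2 / 2)) ^ 2)⁻¹ * (borelHeight (((quasiSplit (↥(maximalRealSubfield L)) L (IsCMField.complexConj L) 3).toAdelic (weylLongU ((IsCMField.complexConj L : L ≃ₐ[↥(maximalRealSubfield L)] L) : L →+* L) (rfl : ((StdForm.antidiagonal 3).over L) = ((StdForm.antidiagonal 3).over L)))) * ((heisChart hc ((((0 : InfiniteAdeleRing L), B) : AdeleRing (𝓞 L) L), traceZeroLine ↥(maximalRealSubfield L) L (IsCMField.complexConj L) hcδ hδ t) : ↥(adelicUnipotent ↥(maximalRealSubfield L) L (IsCMField.complexConj L) 3)) : (quasiSplit (↥(maximalRealSubfield L)) L (IsCMField.complexConj L) 3).Adelic) * k) : ℝ) := by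
  obtain ⟨D, hDn, hD⟩ := exists_archDilate_idele_cm L a
  refine ⟨D, hDn, fun {k} hk B t => ?_⟩
  obtain ⟨hD2, hDw⟩ := hD t
  set ι := InfiniteAdeleRing.ringEquiv_mixedSpace ↥(maximalRealSubfield L) with hι
  -- `t = (ι⁻¹ s, b)` and `D·t = (ι⁻¹ s′, b)`
  have ht : t = ((ι.symm (ι t.1), t.2) : AdeleRing (𝓞 ↥(maximalRealSubfield L)) ↥(maximalRealSubfield L)) := Prod.ext (ι.symm_apply_apply t.1).symm rfl
  have hDt : (D : AdeleRing (𝓞 ↥(maximalRealSubfield L)) ↥(maximalRealSubfield L)) * t = ((ι.symm (ι ((D : AdeleRing (𝓞 ↥(maximalRealSubfield L)) ↥(maximalRealSubfield L)) * t).1), t.2) : AdeleRing (𝓞 ↥(maximalRealSubfield L)) ↥(maximalRealSubfield L)) := Prod.ext (ι.symm_apply_apply _).symm hD2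
  rw [hDt, coe_borelHeight_weylLongU_heisChart_line_mul_eq_cm_three L hc hcδ hδ hk _ t.2 (ι ((D : AdeleRing (𝓞 ↥(maximalRealSubfield L)) ↥(maximalRealSubfield L)) * t).1)]
  conv_rhs => rw [ht, coe_borelHeight_weylLongU_heisChart_line_mul_eq_cm_three L hc hcδ hδ hk _ t.2 (ι t.1)]
  -- the finite factors coincide (they see only `X_f = B`), the archimedean ones scale by `p_w²`
  have hfin : ∀ v : HeightOneSpectrum (𝓞 L),
      (heisZ (c := IsCMField.complexConj L) ((a, B) : AdeleRing (𝓞 L) L) ((traceZeroLine ↥(maximalRealSubfield L) L (IsCMField.complexConj L) hcδ hδ ((0, t.2) : AdeleRing (𝓞 ↥(maximalRealSubfield L)) ↥(maximalRealSubfield L)) : traceZeroAdele ↥(maximalRealSubfield L) L (IsCMField.complexConj L)) : AdeleRing (𝓞 L) L)).2 v =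
      (heisZ (c := IsCMField.complexConj L) (((0 : InfiniteAdeleRing L), B) : AdeleRing (𝓞 L) L) ((traceZeroLine ↥(maximalRealSubfield L) L (IsCMField.complexConj L) hcδ hδ ((0, t.2) : AdeleRing (𝓞 ↥(maximalRealSubfield L)) ↥(maximalRealSubfield L)) : traceZeroAdele ↥(maximalRealSubfield L) L (IsCMField.complexConj L)) : AdeleRing (𝓞 L) L)).2 v := fun v => rfl
  have harch : ∀ w : InfinitePlace L, ((1 + ‖(((a, B) : AdeleRing (𝓞 L) L)).1 w‖ ^ 2 / 2) ^ 2 + (w δ) ^ 2 * ((ι ((D : AdeleRing (𝓞 ↥(maximalRealSubfield L)) ↥(maximalRealSubfield L)) * t).1).1 ⟨w.comap (algebraMap ↥(maximalRealSubfield L) L), K2E1HeightBigCellLineFormulaU2.isReal_comap_maximalRealSubfield L w⟩) ^ 2) =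
      (1 + ‖a w‖ ^ 2 / 2) ^ 2 * ((1 + ‖((((0 : InfiniteAdeleRing L), B) : AdeleRing (𝓞 L) L)).1 w‖ ^ 2 / 2) ^ 2 + (w δ) ^ 2 * ((ι t.1).1 ⟨w.comap (algebraMap ↥(maximalRealSubfield L) L), K2E1HeightBigCellLineFormulaU2.isReal_comap_maximalRealSubfield L w⟩) ^ 2) := by
    intro w
    rw [hDw w]
    show ((1 + ‖a w‖ ^ 2 / 2) ^ 2 + (w δ) ^ 2 * ((1 + ‖a w‖ ^ 2 / 2) * (ι t.1).1 ⟨w.comap (algebraMap ↥(maximalRealSubfield L) L), _⟩) ^ 2) =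
      (1 + ‖a w‖ ^ 2 / 2) ^ 2 * ((1 + ‖(0 : InfiniteAdeleRing L) w‖ ^ 2 / 2) ^ 2 + (w δ) ^ 2 * ((ι t.1).1 ⟨w.comap (algebraMap ↥(maximalRealSubfield L) L), _⟩) ^ 2)
    rw [show (0 : InfiniteAdeleRing L) w = 0 from rfl, norm_zero]
    ring
  simp_rw [hfin, harch, Finset.prod_mul_distrib, Finset.prod_pow]
  ring

/-- **(E-c), COMPLEX POWER — THE CENTRE AVERAGE SCALES BY `(∏_w (1 + ½‖a_w‖²))^{1−2z}`**, HYPOTHESIS-FREE: for every Haar measure `μF` on `𝔸_{L⁺}`, every `φ₀ z : ℂ`,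
`k ∈ K_U`, `a ∈ L ⊗ ℝ`, `B ∈ 𝔸_L^∞`,
`∫ φ₀·H(ι(w₀)·u((a,B), θt)·k)^z dμF(t) = (∏_w (1 + ½‖a_w‖²))^{1−2z} · ∫ φ₀·H(ι(w₀)·u((0,B), θt)·k)^z dμF(t)` (Tate's module for `D(a)` of §2 — a measurable equivalence, so NO
integrability is needed: both sides are Bochner junk together — and the pointwise scaling `exists_archDilate_borelHeight_cm_three`).
[cite: MoeglinWaldspurger1995, II.1.7] [cite: CasselsFrohlichANT1967, Ch. XV Lemma 4.1.2] [cite: Garrett2018, §2.8] -/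
theorem integral_sphericalCentreLine_cpow_eq_prod_cpow_mul_cm_three (hc : IsCMField.complexConj L * IsCMField.complexConj L = 1) {δ : L} (hcδ : IsCMField.complexConj L δ = -δ) (hδ : δ ≠ 0)
    [MeasurableSpace (AdeleRing (𝓞 ↥(maximalRealSubfield L)) ↥(maximalRealSubfield L))] [BorelSpace (AdeleRing (𝓞 ↥(maximalRealSubfield L)) ↥(maximalRealSubfield L))] (μF : Measure (AdeleRing (𝓞 ↥(maximalRealSubfield L)) ↥(maximalRealSubfield L))) [μF.IsAddHaarMeasure] (φ₀ z : ℂ)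
    {k : (quasiSplit (↥(maximalRealSubfield L)) L (IsCMField.complexConj L) 3).Adelic} (hk : k ∈ ((standardMaximalCompactGL 3 L).comap (adelicVal ↥(maximalRealSubfield L) L (IsCMField.complexConj L) 3 ((StdForm.antidiagonal 3).over L)) : Subgroup (quasiSplit (↥(maximalRealSubfield L)) L (IsCMField.complexConj L) 3).Adelic)) (a : InfiniteAdeleRing L) (B : FiniteAdeleRing (𝓞 L) L) :
    ∫ t, φ₀ * (((borelHeight (((quasiSplit (↥(maximalRealSubfield L)) L (IsCMField.complexConj L) 3).toAdelic (weylLongU ((IsCMField.complexConj L : L ≃ₐ[↥(maximalRealSubfield L)] L) : L →+* L) (rfl : ((StdForm.antidiagonal 3).over L) = ((StdForm.antidiagonal 3).over L)))) * ((heisChart hc (((a, B) : AdeleRing (𝓞 L) L), traceZeroLine ↥(maximalRealSubfield L) L (IsCMField.complexConj L) hcδ hδ t) : ↥(adelicUnipotent ↥(maximalRealSubfield L) L (IsCMField.complexConj L) 3)) : (quasiSplit (↥(maximalRealSubfield L)) L (IsCMField.complexConj L) 3).Adelic) * k) : ℝ)) : ℂ) ^ z ∂μF = (((∏ w : InfinitePlace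 L, (1 + ‖a w‖ ^ 2 / 2)) : ℝ) : ℂ) ^ (1 - 2 * z) * ∫ t, φ₀ * (((borelHeight (((quasiSplit (↥(maximalRealSubfield L)) L (IsCMField.complexConj L) 3).toAdelic (weylLongU ((IsCMField.complexConj L : L ≃ₐ[↥(maximalRealSubfield L)] L) : L →+* L) (rfl : ((StdForm.antidiagonal 3).over L) = ((StdForm.antidiagonal 3).over L)))) * ((heisChart hc ((((0 : InfiniteAdeleRing L), B) : AdeleRing (𝓞 L) L), traceZeroLine ↥(maximalRealSubfield L) L (IsCMField.complexConj L) hcδ hδ t) : ↥(adelicUnipotent ↥(maximalRealSubfield L) L (IsCMField.complexConj L) 3)) : (quasiSplit (↥(maximalRealSubfield L)) L (IsCMField.complexConj L) 3).Adelic) * k) : ℝ)) : ℂ) ^ z ∂μF := by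
  obtain ⟨D, hDn, hD⟩ := exists_archDilate_borelHeight_cm_three L hc hcδ hδ a
  have hPpos : 0 < (∏ w : InfinitePlace L, (1 + ‖a w‖ ^ 2 / 2)) := Finset.prod_pos fun w _ => one_add_half_norm_sq_pos L a w
  -- Tate's module for `D`: `∫ f = ‖D‖ • ∫ f(D·t)`, hypothesis-free
  have key : ∀ f : AdeleRing (𝓞 ↥(maximalRealSubfield L)) ↥(maximalRealSubfield L) → ℂ, ∫ t, f t ∂μF = (∏ w : InfinitePlace L, (1 + ‖a w‖ ^ 2 / 2)) • ∫ t, f ((D : AdeleRing (𝓞 ↥(maximalRealSubfield L)) ↥(maximalRealSubfield L)) * t) ∂μF := fun f => by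
    rw [integral_comp_units_mul_eq_smul ↥(maximalRealSubfield L) μF D f, hDn, smul_smul, mul_inv_cancel₀ hPpos.ne', one_smul]
  rw [key (fun t => φ₀ * (((borelHeight (((quasiSplit (↥(maximalRealSubfield L)) L (IsCMField.complexConj L) 3).toAdelic (weylLongU ((IsCMField.complexConj L : L ≃ₐ[↥(maximalRealSubfield L)] L) : L →+* L) (rfl : ((StdForm.antidiagonal 3).over L) = ((StdForm.antidiagonal 3).over L)))) * ((heisChart hc (((a, B) : AdeleRing (𝓞 L) L), traceZeroLine ↥(maximalRealSubfield L) L (IsCMField.complexConj L) hcδ hδ t) : ↥(adelicUnipotent ↥(maximalRealSubfield L) L (IsCMField.complexConj L) 3)) : (quasiSplit (↥(maximalRealSubfield L)) L (IsCMField.complexConj L) 3).Adelic) * k) : ℝ)) : ℂ) ^ z)]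
  simp_rw [hD hk B]
  rw [integral_const_mul_ofReal_mul_cpow μF φ₀ z (inv_nonneg.mpr (pow_nonneg hPpos.le 2)) (fun t => borelHeight (((quasiSplit (↥(maximalRealSubfield L)) L (IsCMField.complexConj L) 3).toAdelic (weylLongU ((IsCMField.complexConj L : L ≃ₐ[↥(maximalRealSubfield L)] L) : L →+* L) (rfl : ((StdForm.antidiagonal 3).over L) = ((StdForm.antidiagonal 3).over L)))) * ((heisChart hc ((((0 : InfiniteAdeleRing L), B) : AdeleRing (𝓞 L) L), traceZeroLine ↥(maximalRealSubfield L) L (IsCMField.complexConj L) hcδ hδ t) : ↥(adelicUnipotent ↥(maximalRealSubfield L) L (IsCMField.complexConj L) 3)) : (quasiSplit (↥(maximalRealSubfield L)) L (IsCMField.complexConj L) 3).Adelic) * k)), Complex.real_smul, ← mul_assoc,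
    ofReal_mul_inv_sq_cpow hPpos]

/-- **(E-c) FOR THE FLAT SPHERICAL SECTION `f_z = φ₀·H^z`** (the integrand of the centre average `(f_z)_{Z,μF}` of ★ `…DecayInputsU3`, literally):
`∫ f_z(ι(w₀)·u((a,B), θt)·k) dμF = (∏_w (1 + ½‖a_w‖²))^{1−2z} · ∫ f_z(ι(w₀)·u((0,B), θt)·k) dμF`, hypothesis-free. [cite: MoeglinWaldspurger1995, II.1.7] -/
theorem integral_flatSectionU_const_centre_eq_prod_cpow_mul_cm_three (hc : IsCMField.complexConj L * IsCMField.complexConj L = 1) {δ : L} (hcδ : IsCMField.complexConj L δ = -δ) (hδ : δ ≠ 0)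
    [MeasurableSpace (AdeleRing (𝓞 ↥(maximalRealSubfield L)) ↥(maximalRealSubfield L))] [BorelSpace (AdeleRing (𝓞 ↥(maximalRealSubfield L)) ↥(maximalRealSubfield L))] (μF : Measure (AdeleRing (𝓞 ↥(maximalRealSubfield L)) ↥(maximalRealSubfield L))) [μF.IsAddHaarMeasure] (φ₀ z : ℂ)
    {k : (quasiSplit (↥(maximalRealSubfield L)) L (IsCMField.complexConj L) 3).Adelic} (hk : k ∈ ((standardMaximalCompactGL 3 L).comap (adelicVal ↥(maximalRealSubfield L) L (IsCMField.complexConj L) 3 ((StdForm.antidiagonal 3).over L)) : Subgroup (quasiSplit (↥(maximalRealSubfield L)) L (IsCMField.complexConj L) 3).Adelic)) (a : InfiniteAdeleRing L) (B : FiniteAdeleRing (𝓞 L) L) :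
    ∫ t, flatSectionU (fun _ : (quasiSplit (↥(maximalRealSubfield L)) L (IsCMField.complexConj L) 3).Adelic => φ₀) z (((quasiSplit (↥(maximalRealSubfield L)) L (IsCMField.complexConj L) 3).toAdelic (weylLongU ((IsCMField.complexConj L : L ≃ₐ[↥(maximalRealSubfield L)] L) : L →+* L) (rfl : ((StdForm.antidiagonal 3).over L) = ((StdForm.antidiagonal 3).over L)))) * ((heisChart hc (((a, B) : AdeleRing (𝓞 L) L), traceZeroLine ↥(maximalRealSubfield L) L (IsCMField.complexConj L) hcδ hδ t) : ↥(adelicUnipotent ↥(maximalRealSubfield L) L (IsCMField.complexConj L) 3)) : (quasiSplit (↥(maximalRealSubfield L)) L (IsCMField.complexConj L) 3).Adelic) * k) ∂μF =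
      (((∏ w : InfinitePlace L, (1 + ‖a w‖ ^ 2 / 2)) : ℝ) : ℂ) ^ (1 - 2 * z) * ∫ t, flatSectionU (fun _ : (quasiSplit (↥(maximalRealSubfield L)) L (IsCMField.complexConj L) 3).Adelic => φ₀) z (((quasiSplit (↥(maximalRealSubfield L)) L (IsCMField.complexConj L) 3).toAdelic (weylLongU ((IsCMField.complexConj L : L ≃ₐ[↥(maximalRealSubfield L)] L) : L →+* L) (rfl : ((StdForm.antidiagonal 3).over L) = ((StdForm.antidiagonal 3).over L)))) * ((heisChart hc ((((0 : InfiniteAdeleRing L), B) : AdeleRing (𝓞 L) L), traceZeroLine ↥(maximalRealSubfield L) L (IsCMField.complexConj L) hcδ hδ t) : ↥(adelicUnipotent ↥(maximalRealSubfield L) L (IsCMField.complexConj L) 3)) : (quasiSplit (↥(maximalRealSubfield L)) L (IsCMField.complexConj L) 3).Adelic) * k) ∂μF := by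
  simp only [flatSectionU_apply]
  exact integral_sphericalCentreLine_cpow_eq_prod_cpow_mul_cm_three L hc hcδ hδ μF φ₀ z hk a B

/-- **(E-c), REAL POWER — THE MAJORANT SCALES BY `(∏_w (1 + ½‖a_w‖²))^{1−2σ}`**, HYPOTHESIS-FREE:
`∫ C·H(ι(w₀)·u((a,B), θt)·k)^σ dμF(t) = (∏_w (1 + ½‖a_w‖²))^{1−2σ} · ∫ C·H(ι(w₀)·u((0,B), θt)·k)^σ dμF(t)` (the right-hand sides of the `hφarchZ` bounds of ★ p858259).
[cite: MoeglinWaldspurger1995, II.1.7] [cite: CasselsFrohlichANT1967, Ch. XV Lemma 4.1.2] -/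
theorem integral_sphericalCentreLine_rpow_eq_prod_rpow_mul_cm_three (hc : IsCMField.complexConj L * IsCMField.complexConj L = 1) {δ : L} (hcδ : IsCMField.complexConj L δ = -δ) (hδ : δ ≠ 0)
    [MeasurableSpace (AdeleRing (𝓞 ↥(maximalRealSubfield L)) ↥(maximalRealSubfield L))] [BorelSpace (AdeleRing (𝓞 ↥(maximalRealSubfield L)) ↥(maximalRealSubfield L))] (μF : Measure (AdeleRing (𝓞 ↥(maximalRealSubfield L)) ↥(maximalRealSubfield L))) [μF.IsAddHaarMeasure] (C σ : ℝ)
    {k : (quasiSplit (↥(maximalRealSubfield L)) L (IsCMField.complexConj L) 3).Adelic} (hk : k ∈ ((standardMaximalCompactGL 3 L).comap (adelicVal ↥(maximalRealSubfield L) L (IsCMField.complexConj L) 3 ((StdForm.antidiagonal 3).over L)) : Subgroup (quasiSplit (↥(maximalRealSubfield L)) L (IsCMField.complexConj L) 3).Adelic)) (a : InfiniteAdeleRing L) (B : FiniteAdeleRing (𝓞 L) L) :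
    ∫ t, C * ((borelHeight (((quasiSplit (↥(maximalRealSubfield L)) L (IsCMField.complexConj L) 3).toAdelic (weylLongU ((IsCMField.complexConj L : L ≃ₐ[↥(maximalRealSubfield L)] L) : L →+* L) (rfl : ((StdForm.antidiagonal 3).over L) = ((StdForm.antidiagonal 3).over L)))) * ((heisChart hc (((a, B) : AdeleRing (𝓞 L) L), traceZeroLine ↥(maximalRealSubfield L) L (IsCMField.complexConj L) hcδ hδ t) : ↥(adelicUnipotent ↥(maximalRealSubfield L) L (IsCMField.complexConj L) 3)) : (quasiSplit (↥(maximalRealSubfield L)) L (IsCMField.complexConj L) 3).Adelic) * k) : ℝ)) ^ σ ∂μF = (∏ w : InfinitePlace L, (1 + ‖a w‖ ^ 2 / 2)) ^ (1 - 2 * σ) * ∫ t, C * ((borelHeight (((quasiSplit (↥(maximalRealSubfield L)) L (IsCMField.complexConj L) 3).toAdelic (weylLongU ((IsCMField.complexConj L : L ≃ₐ[↥(maximalRealSubfield L)] L) : L →+* L) (rfl : ((StdForm.antidiagonal 3).over L) = ((StdForm.antidiagonal 3).over L)))) * ((heisChart hc ((((0 : InfiniteAdeleRing L), B) : AdeleRing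 (𝓞 L) L), traceZeroLine ↥(maximalRealSubfield L) L (IsCMField.complexConj L) hcδ hδ t) : ↥(adelicUnipotent ↥(maximalRealSubfield L) L (IsCMField.complexConj L) 3)) : (quasiSplit (↥(maximalRealSubfield L)) L (IsCMField.complexConj L) 3).Adelic) * k) : ℝ)) ^ σ ∂μF := by
  obtain ⟨D, hDn, hD⟩ := exists_archDilate_borelHeight_cm_three L hc hcδ hδ a
  have hPpos : 0 < (∏ w : InfinitePlace L, (1 + ‖a w‖ ^ 2 / 2)) := Finset.prod_pos fun w _ => one_add_half_norm_sq_pos L a w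
  have key : ∀ f : AdeleRing (𝓞 ↥(maximalRealSubfield L)) ↥(maximalRealSubfield L) → ℝ, ∫ t, f t ∂μF = (∏ w : InfinitePlace L, (1 + ‖a w‖ ^ 2 / 2)) • ∫ t, f ((D : AdeleRing (𝓞 ↥(maximalRealSubfield L)) ↥(maximalRealSubfield L)) * t) ∂μF := fun f => by
    rw [integral_comp_units_mul_eq_smul ↥(maximalRealSubfield L) μF D f, hDn, smul_smul, mul_inv_cancel₀ hPpos.ne', one_smul]
  rw [key (fun t => C * ((borelHeight (((quasiSplit (↥(maximalRealSubfield L)) L (IsCMField.complexConj L) 3).toAdelic (weylLongU ((IsCMField.complexConj L : L ≃ₐ[↥(maximalRealSubfield L)] L) : L →+* L) (rfl : ((StdForm.antidiagonal 3).over L) = ((StdForm.antidiagonal 3).over L)))) * ((heisChart hc (((a, B) : AdeleRing (𝓞 L) L), traceZeroLine ↥(maximalRealSubfield L) L (IsCMField.complexConj L) hcδ hδ t) : ↥(adelicUnipotent ↥(maximalRealSubfield L) L (IsCMField.complexConj L) 3)) : (quasiSplit (↥(maximalRealSubfield L)) L (IsCMField.complexConj L) 3).Adelic) * k) : ℝ))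 ^ σ)]
  simp_rw [hD hk B]
  rw [integral_const_mul_mul_rpow μF C σ (inv_nonneg.mpr (pow_nonneg hPpos.le 2)) (fun t => borelHeight (((quasiSplit (↥(maximalRealSubfield L)) L (IsCMField.complexConj L) 3).toAdelic (weylLongU ((IsCMField.complexConj L : L ≃ₐ[↥(maximalRealSubfield L)] L) : L →+* L) (rfl : ((StdForm.antidiagonal 3).over L) = ((StdForm.antidiagonal 3).over L)))) * ((heisChart hc ((((0 : InfiniteAdeleRing L), B) : AdeleRing (𝓞 L) L), traceZeroLine ↥(maximalRealSubfield L) L (IsCMField.complexConj L) hcδ hδ t) : ↥(adelicUnipotent ↥(maximalRealSubfield L) L (IsCMField.complexConj L) 3)) : (quasiSplit (↥(maximalRealSubfield L)) L (IsCMField.complexConj L) 3).Adelic) * k)), smul_eq_mul, ← mul_assoc, mul_inv_sq_rpow hPpos]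

end CM

end Summit.HodgeConjecture.HodgeConjecture.Cruxes.H413.K2E1CentreAverageScalingU3

end
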